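import Mathlib
import Literature.NumberTheory.Transcendental.LinEDS
import Literature.NumberTheory.Transcendental.LinEDSCode
import Literature.NumberTheory.Transcendental.MultipleZetaStuffle
import Literature.NumberTheory.Transcendental.MZVWordShuffle
import Summits.KontsevichZagierPeriods.KontsevichZagierPeriods.Theorems.FurushoPentagonKernelModuloPeriodConjectureShBitsTestBit
import Summits.KontsevichZagierPeriods.KontsevichZagierPeriods.Theorems.FurushoPentagonKernelModuloPeriodConjectureStBitsTestBit
import HarnessLib

/-!
# `KernelModuloPeriodConjecture`, line `Sketch`: row parity (E9), part A — the raw row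

Crux `FurushoPentagon.KernelModuloPeriodConjecture` (stmt-KontsevichZagierPeriods-15058), line
`Sketch`, towards the registered stub `stub_rowBits_parity` of the lead's skeleton v11 (soundness
of the kernel-checkable GF(2) rank engine `Literature/NumberTheory/Transcendental/LinEDS.lean`).
Part A: the coefficients of the INTEGER double-shuffle row `LinEDS.rowZ (s,t)` — explicit formula,
support (binary words of weight `wt s + wt t`), and their parities: for a word `w` of that length,
`rowZ (s,t) w` is odd iff bit `code w` of the raw bitset row `LinEDS.rawBits (s,t)` is set
(assembling E1 `stub_shBits_testBit` and E2 `stub_stBits_testBit`). Parities are computed in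
`ZMod 2`.

References: K. Ihara, M. Kaneko, D. Zagier, Compos. Math. 142 (2006) §2 [IharaKanekoZagier2006].
-/

namespace Summit.KontsevichZagierPeriods.FurushoPentagon.KernelModuloPeriodConjecture

open Literature.NumberTheory.Transcendental
open Literature.NumberTheory.Transcendental.LinEDS

/-! ### Bits as elements of `ZMod 2` (`b ↦ (b.toNat : ZMod 2)`) -/

/-- A bit `b` is read in `ZMod 2` as `(b.toNat : ZMod 2)`; the bit of an exclusive or is the
sum. [folklore] -/
theorem rowE9bit_xor (a b : Bool) : ((a ^^ b).toNat : ZMod 2) = (a.toNat : ZMod 2) + b.toNat := by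
  cases a <;> cases b <;> decide

/-- A natural number mod 2 is the bit of its parity. [folklore] -/
theorem rowE9_natCast_eq_bit_decide (n : ℕ) : (n : ZMod 2) = ((decide (Odd n)).toNat : ZMod 2) := by
  rcases Nat.even_or_odd n with h | h
  · rw [show decide (Odd n) = false from by simpa using Nat.not_odd_iff_even.mpr h]
    exact ZMod.natCast_eq_zero_iff_even.mpr h
  · rw [show decide (Odd n) = true from by simpa using h]
    exact ZMod.natCast_eq_one_iff_odd.mpr h

/-- A natural number mod 2 is the bit `Nat.bodd`. [folklore] -/
theorem rowE9_natCast_eq_bit_bodd (n : ℕ) : (n : ZMod 2) = (n.bodd.toNat : ZMod 2) := by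
  rw [rowE9_natCast_eq_bit_decide]
  have : decide (Odd n) = n.bodd := by
    rw [Bool.eq_iff_iff, decide_eq_true_iff, shBitsE1_bodd_eq_true_iff]
  rw [this]

/-- An integer is odd iff it is `1` mod 2, in bit form. [folklore] -/
theorem rowE9_odd_iff_cast_eq_one (z : ℤ) : Odd z ↔ (z : ZMod 2) = 1 := by
  constructor
  · rintro ⟨m, rfl⟩
    push_cast
    rw [show (2 : ZMod 2) = 0 from rfl]; ring
  · intro h
    rcases Int.even_or_odd z with he | ho
    · obtain ⟨m, rfl⟩ := he
      have : ((m + m : ℤ) : ZMod 2) = 0 := by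
        push_cast; rw [← two_mul, show (2 : ZMod 2) = 0 from rfl, zero_mul]
      rw [this] at h
      exact absurd h (by decide)
    · exact ho

/-- `(b.toNat : ZMod 2) = 1 ↔ b = true`. [folklore] -/
theorem rowE9bit_eq_one_iff (b : Bool) : (b.toNat : ZMod 2) = 1 ↔ b = true := by
  cases b <;> decide

/-! ### Coefficients of sums of singles -/

/-- Applying a list-indexed sum of `Finsupp.single`s. [folklore] -/
theorem rowE9_sum_single_apply {β : Type*} (L : List β) (g : β → List Bool) (h : β → ℤ)
    (w : List Bool) :
    ((L.map fun u => Finsupp.single (g u) (h u)).sum) w =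
      (L.map fun u => if g u = w then h u else 0).sum := by
  induction L with
  | nil => simp
  | cons u L ih =>
    simp only [List.map_cons, List.sum_cons, Finsupp.add_apply, ih, Finsupp.single_apply]

/-- `wordSumZ L w` is the multiplicity of `w` in `L`. [folklore] -/
theorem rowE9_wordSumZ_apply (L : List (List Bool)) (w : List Bool) :
    LinEDS.wordSumZ L w = (L.count w : ℤ) := by
  rw [LinEDS.wordSumZ, rowE9_sum_single_apply]
  induction L with
  | nil => simp
  | cons v L ih =>
    simp only [List.map_cons, List.sum_cons, ih, List.count_cons, Nat.cast_add, Nat.cast_ite,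
      Nat.cast_one, Nat.cast_zero, beq_iff_eq]
    ring

/-- **The coefficients of the integer row.** [cite: IharaKanekoZagier2006, §2] -/
theorem rowE9_rowZ_apply (ν : List ℕ × List ℕ) (w : List Bool) :
    LinEDS.rowZ ν w =
      ((MZV.stuffle ν.1 ν.2).map fun u =>
          if MZV.binaryWord u = w then (-1 : ℤ) ^ u.length else 0).sum -
        (-1 : ℤ) ^ (ν.1.length + ν.2.length) *
          ((MZV.shuffleWord (MZV.binaryWord ν.1) (MZV.binaryWord ν.2)).count w : ℤ) := by
  rw [LinEDS.rowZ, Finsupp.sub_apply, Finsupp.smul_apply, smul_eq_mul, rowE9_sum_single_apply,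
    rowE9_wordSumZ_apply]

/-- A list sum of `±1`-or-`0` terms, mod 2, is the count of the nonzero terms. [folklore] -/
theorem rowE9_cast_sum_ite_pow (L : List (List ℕ)) (p : List ℕ → Prop) [DecidablePred p] :
    (((L.map fun u => if p u then (-1 : ℤ) ^ u.length else 0).sum : ℤ) : ZMod 2) =
      (L.countP fun u => decide (p u) : ℕ) := by
  induction L with
  | nil => simp
  | cons u L ih =>
    rw [List.map_cons, List.sum_cons, Int.cast_add, ih, List.countP_cons]
    by_cases hu : p u
    · simp only [hu, if_true, decide_true, Nat.cast_add, Nat.cast_one]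
      push_cast
      rw [show (-1 : ZMod 2) ^ u.length = 1 from by rw [show (-1 : ZMod 2) = 1 from by decide, one_pow]]
      ring
    · simp [hu]

/-- **The integer row mod 2, as counts.** [cite: IharaKanekoZagier2006, §2] -/
theorem rowE9_rowZ_cast (ν : List ℕ × List ℕ) (w : List Bool) :
    ((LinEDS.rowZ ν w : ℤ) : ZMod 2) =
      ((MZV.stuffle ν.1 ν.2).countP fun u => decide (MZV.binaryWord u = w) : ℕ) +
        ((MZV.shuffleWord (MZV.binaryWord ν.1) (MZV.binaryWord ν.2)).count w : ℕ) := by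
  rw [rowE9_rowZ_apply, Int.cast_sub, rowE9_cast_sum_ite_pow, Int.cast_mul, Int.cast_pow,
    show ((-1 : ℤ) : ZMod 2) = 1 from by decide, one_pow, one_mul, Int.cast_natCast,
    sub_eq_add_neg, ZMod.neg_eq_self_mod_two]

/-! ### Support of the integer row -/

/-- Every word in the support of `rowZ (s,t)` is a `binaryWord u`, `u ∈ s ∗ t`, or a shuffle of
`binaryWord s` and `binaryWord t`. [folklore] -/
theorem rowE9_mem_support_rowZ {ν : List ℕ × List ℕ} {w : List Bool}
    (hw : w ∈ (LinEDS.rowZ ν).support) :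
    (∃ u ∈ MZV.stuffle ν.1 ν.2, MZV.binaryWord u = w) ∨
      w ∈ MZV.shuffleWord (MZV.binaryWord ν.1) (MZV.binaryWord ν.2) := by
  rw [Finsupp.mem_support_iff, rowE9_rowZ_apply] at hw
  by_contra h
  push Not at h
  apply hw
  have h1 : ((MZV.stuffle ν.1 ν.2).map fun u =>
      if MZV.binaryWord u = w then (-1 : ℤ) ^ u.length else 0).sum = 0 := by
    apply List.sum_eq_zero
    intro x hx
    obtain ⟨u, hu, rfl⟩ := List.mem_map.mp hx
    rw [if_neg (h.1 u hu)]
  rw [h1, List.count_eq_zero_of_not_mem h.2]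
  simp

/-- Words in the support of `rowZ (s,t)` (positive entries) have length `wt s + wt t`.
[folklore] -/
theorem rowE9_length_of_mem_support {ν : List ℕ × List ℕ} (hs : ∀ a ∈ ν.1, 1 ≤ a)
    (ht : ∀ b ∈ ν.2, 1 ≤ b) {w : List Bool} (hw : w ∈ (LinEDS.rowZ ν).support) :
    w.length = ν.1.sum + ν.2.sum := by
  rcases rowE9_mem_support_rowZ hw with ⟨u, hu, rfl⟩ | hw
  · rw [MZV.length_binaryWord (MZV.one_le_of_mem_stuffle _ _ hs ht u hu), MZV.weight,
      MZV.sum_of_mem_stuffle _ _ hu]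
  · rw [MZV.length_of_mem_shuffleWord _ _ hw, MZV.length_binaryWord hs, MZV.length_binaryWord ht,
      MZV.weight, MZV.weight]

/-! ### Parity of the coefficients = bits of the raw row -/

/-- **Row parity, raw form.** For `s, t` with positive entries and a word `w` of length
`wt s + wt t`: `rowZ (s,t) w` is, mod 2, bit `code w` of `rawBits (s,t)`.
[cite: IharaKanekoZagier2006, §2] -/
theorem rowE9_rowZ_cast_eq_bit {ν : List ℕ × List ℕ} (hs : ∀ a ∈ ν.1, 1 ≤ a)
    (ht : ∀ b ∈ ν.2, 1 ≤ b) {w : List Bool} (hw : w.length = ν.1.sum + ν.2.sum) :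
    ((LinEDS.rowZ ν w : ℤ) : ZMod 2) =
      (((LinEDS.rawBits ν).testBit (LinEDS.code w)).toNat : ZMod 2) := by
  rw [rowE9_rowZ_cast, LinEDS.rawBits, Nat.testBit_xor, rowE9bit_xor, stBitsE2_testBit_eq,
    shBitsE1_testBit_eq_bodd, ← rowE9_natCast_eq_bit_decide, ← rowE9_natCast_eq_bit_bodd]
  congr 2
  · refine List.countP_congr fun u hu => ?_
    simp only [decide_eq_true_eq]
    have hupos := MZV.one_le_of_mem_stuffle _ _ hs ht u hu
    have hlen : (MZV.binaryWord u).length = w.length := by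
      rw [MZV.length_binaryWord hupos, MZV.weight, MZV.sum_of_mem_stuffle _ _ hu, hw]
    rw [icode_eq_code_binaryWord hupos]
    exact ⟨fun h => h ▸ rfl, fun h => code_injective hlen h⟩
  · rw [List.count_eq_countP]
    refine List.countP_congr fun v hv => ?_
    have hlen : v.length = w.length := by
      rw [MZV.length_of_mem_shuffleWord _ _ hv, MZV.length_binaryWord hs, MZV.length_binaryWord ht,
        MZV.weight, MZV.weight, hw]
    simp only [beq_iff_eq, decide_eq_true_eq]
    exact ⟨fun h => h ▸ rfl, fun h => code_injective hlen h⟩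

/-- Consequently `rowZ (s,t) w` is ODD iff bit `code w` of the raw row is set. [folklore] -/
theorem rowE9_odd_rowZ_iff {ν : List ℕ × List ℕ} (hs : ∀ a ∈ ν.1, 1 ≤ a)
    (ht : ∀ b ∈ ν.2, 1 ≤ b) {w : List Bool} (hw : w.length = ν.1.sum + ν.2.sum) :
    Odd (LinEDS.rowZ ν w) ↔ (LinEDS.rawBits ν).testBit (LinEDS.code w) = true := by
  rw [rowE9_odd_iff_cast_eq_one, rowE9_rowZ_cast_eq_bit hs ht hw, rowE9bit_eq_one_iff]

/-- **Registered helper stub `stub_rowZ_parity_raw`** (lead c5, E9 part A; crux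
stmt-KontsevichZagierPeriods-15058, line `Sketch`): for row names with positive entries, a
coefficient `rowZ (s,t) w` of the integer double-shuffle row at a word of length `wt s + wt t` is odd
iff bit `code w` of the raw bitset row is set. [cite: IharaKanekoZagier2006, §2] -/
theorem stub_rowZ_parity_raw :
    ∀ (ν : List ℕ × List ℕ), (∀ a ∈ ν.1, 1 ≤ a) → (∀ b ∈ ν.2, 1 ≤ b) → ∀ w : List Bool,
      w.length = ν.1.sum + ν.2.sum →
        (Odd (LinEDS.rowZ ν w) ↔ (LinEDS.rawBits ν).testBit (LinEDS.code w) = true) :=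
  fun _ hs ht _ hw => rowE9_odd_rowZ_iff hs ht hw

end Summit.KontsevichZagierPeriods.FurushoPentagon.KernelModuloPeriodConjecture
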